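import Mathlib
import HarnessLib
import Summits.HubbardSuperconductivity.HubbardSuperconductivity.Theorems.KLProgrammeKLRegimeSplitGlueP4
import Summits.HubbardSuperconductivity.HubbardSuperconductivity.Theorems.KLProgrammeKLRegimeSplitBundleV10

/-!
# Route `KLProgramme` — the K3-NAMED glue of the five gen-3 children at the bundle `klPredsV10` (Δ16 + Δ18 + Δ-UV), v4 staging (`EngineP4` /
# `VolumeLimitP2`, p1's `…SplitGlueP4`) (stmt-HubbardSuperconductivity-19937; DOWNSTREAM of the route file; cell gate-hubbard-kl, seat
# hubbard-kl-k3c2-p3)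

`KLRegimeInductionV10P4 := KLRegimeInductionP4 klPredsV10 FinalTwoLegVolLimit`.  Nothing else is asserted.
-/

noncomputable section

namespace Summit.HubbardSuperconductivity.HubbardSuperconductivity.Theorems.KLRegimeSplit

set_option linter.dupNamespace false -- summit = problem name (single-conjunct summit), D-0017

/-- **The K3-named glue at `klPredsV10`, v4 staging**: `EngineP4 klPredsV10 klWindowC`, `BetaSplitP klPredsV10 klWindowC`,
`CountertermP2 klPredsV10 klWindowC`, `VolumeLimitP2 klPredsV10 FinalTwoLegVolLimit klWindowC`, `TwoPointAssemblyP3 klPredsV10 FinalTwoLegVolLimit klWindowC`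
imply crux K3 `KLRegimeTwoPointLimit` BY NAME. -/
theorem KLRegimeInductionV10P4 :
    EngineP4 klPredsV10 klWindowC → BetaSplitP klPredsV10 klWindowC → CountertermP2 klPredsV10 klWindowC →
      VolumeLimitP2 klPredsV10 FinalTwoLegVolLimit klWindowC → TwoPointAssemblyP3 klPredsV10 FinalTwoLegVolLimit klWindowC →
        Summit.HubbardSuperconductivity.HubbardSuperconductivity.Theses.KLProgramme.KLRegimeTwoPointLimit :=
  KLRegimeInductionP4 klPredsV10 FinalTwoLegVolLimit

end Summit.HubbardSuperconductivity.HubbardSuperconductivity.Theorems.KLRegimeSplit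

end
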